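import Mathlib
import HarnessLib
import HarnessLib.Audit
import Summits.QuantumFields.Statement
import Summits.QuantumFields.YangMills.Theorems.CurvatureBoostCovariance.Negative.Unbundled
import Summits.QuantumFields.YangMills.Theorems.NPointIsotropy.Negative.NPointRegularJunk
import HarnessLib.Audit.Status.Attr

/-!
Route: IsotropyFromPowerCounting

# Route IsotropyFromPowerCounting — E1 of the Wilson limit from UV power counting — tempered moments
plus heat-sandwich slack μ<4, boost engine certified

DECOMPOSITION-FIRST (lens 3.4) on the deciding crux of the summit's one B-ceiling route: the engine
B′ =
`MirrorModularBoosts.SoftKernelBoostCovariance` (stmt-QuantumFields-14999: planar rotation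
invariance of the curvature
channel tr F² of a Wilson limit from sixteen mirrors, the planar cone and the soft kernel) is SPLIT
into its two
Yang–Mills inputs, both UV POWER-COUNTING statements with no symmetry content, and the implication
`T → Σ → B′` is
PROVED (item EngineFromPowerCounting — kernel-checked over the landed composition p135724 and the
landed Step-0
halves p108509 / p109000; crux-kind rank 9 by the crux-only layer invariant and consumed by `closes`
as a binder, see ## Assembly). It suffices to show X = Σ ∧ T ∧ K ∧ D ∧ H⁺: (Σ)
CurvatureSandwichBound — for the curvature
channel S₁ of every Wilson limit (package W1, eight planar frames, cone, soft kernel) and for its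
45° pull-back, the
heat-sandwich bound ‖e^{−uH} φ(g⊗hh) e^{−vH} Ψ‖ ≤ C‖g‖₁(‖hh‖₁+‖hh‖_∞)(u^{−μ}+v^{−μ})‖Ψ‖ on OS
vectors with ONE POWER OF
SLACK, μ < 4 (tr F² has dimension 4 < 5); (T) TemperedCurvatureMoments — k-uniformly tempered
lattice moment densities
tied to 𝔖ₙ|⁰𝒮; (K) CurvatureKernelBound, (D) DiagonalMirrorRPR, (H⁺) WeakCouplingHypercubicLimit —
the parent's three
other open cruxes, shared verbatim (stmt-11687, 10604, 16154). Realises the split foreseen by card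
mirror-wedges-modular-boosts-v2's route and the crux idea transverse-slack-heat-sandwich.
Lean: `Summit.QuantumFields.YangMills.Theses.IsotropyFromPowerCounting.CurvatureSandwichBound ∧
Summit.QuantumFields.YangMills.Theses.IsotropyFromPowerCounting.TemperedCurvatureMoments ∧
Summit.QuantumFields.YangMills.Theses.MirrorModularBoosts.CurvatureKernelBound ∧
Summit.QuantumFields.YangMills.Theses.MirrorModularBoosts.DiagonalMirrorRPR ∧
Summit.QuantumFields.YangMills.Theses.MirrorModularBoosts.WeakCouplingHypercubicLimit`

## Assembly
LOGIC-ONLY deciding theorem (glue.lean `closes`; cone repair 2026-08-17, revs 1–3): binders = the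
five cruxes Σ, T, K, D, H⁺ plus the
two CERTIFIED items E = EngineFromPowerCounting (T → Σ → B′, kernel-checked) and C =
PlanarSpectralCone (MirrorModularBoosts' PROVED
stmt-9664, `PlanarSpectralCone_of`; refiled verbatim for this route as stmt-18313); `closes :=
MirrorModularBoosts.closes hK (hE hT hSig) hC hD hH`,
i.e. B′ from T and Σ by E, then the parent's certified chain — K feeds B′ the kernel triple,
CurvatureChannel (landed) restricts H⁺'s
witness to the curvature channel with the axis frames, D gives the diagonal frames, B′ gives planar
rotations of every curvature string,
the one-field reduction (landed) renormalises the other species to zero, PlanarToEuclidean (landed)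
upgrades proper-hypercubic + planar to
SO(4), and the OS data with IsYangMillsFor, non-triviality, non-Gaussianity, HasMassGap,
HasLatticeMassGap and the weak-coupling clause are
read off. E and C are BINDERS, not imports, because their landed proof modules
(…SoftKernelBoostCovarianceOfInputs, cone 318 modules;
…MirrorModularBoostsPlanarSpectralCone, cone 187) carry 13 unproved Literature facts by module
co-location (Wightman / WightmanProofs /
OSTimeContinuation / LatticeGauge / Sweep1 — none used here); both close through Theorems files that
import THIS route file (E: the rev-0
closes body — Step 0 from T via stub_dominatedTieLimit + stub_regular_of_dominated, R := planeRot 0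
(π/4) by planeRot_coords, then
stub_cruxOfInputs; C: `PlanarSpectralCone_of`). Import cone after repair: 74 modules = the
Statement's + the parent's, 0 fact-laden.

Rationale: WHY THIS LINE. The parent route manufactures the rotation half of E1 for tr F² from reflection
positivity in sixteen lattice mirrors
(Borchers1992, OsterwalderSchrader1975 §4.2 run backwards); its judge risk was "no engine at sieve
level ≥ 2". That engine
now exists and is LANDED (line Sketch of crux 14999, 25 Theorems files, composition p135724):
complex planar rotations are
boosts once the cone holds, boost vectors come out of ONE operator chain (cone family + transversely
filtered heat
sandwich), the parity sieve closes every level — MODULO exactly two properties of the Wilson limit,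
Σ (an H-bound in the
sense of FredenhagenHertel1981 / Glimm–Jaffe φ-bounds, GlimmJaffe1987 §19, with a dimension-4 power
law) and T
(OsterwalderSchrader1975 E0′-type temperedness of the renormalised lattice moments, the output class
of
Balaban1989LargeFieldII / MagnenRivasseauSeneor1993). Promoting the certified split to route level
converts the
deciding bet of the E1 programme from a SYMMETRY statement (refutable by an anisotropic gapped
Wilson limit) into two
REGULARITY statements (refutable only by tr F² acquiring anomalous dimension ≥ 5 in an
asymptotically free theory), files
them ONCE for the three crux lines that registered them byte-identically (9663, 11686, 14999; Σ now
up to naming the 45° frame by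
coordinates instead of `planeRot`, cone repair rev 3, equivalence kernel-checked in evidence
Bridge.lean), and exposes them to
refuters and disprovers as items. Imported areas: algebraic QFT energy bounds (Σ), constructive-QFT
temperedness (T); the
modular/several-complex-variables machinery of the parent is consumed as landed theorems, not
assumed. Negatives index:
only the parent's unrepaired DiagonalMirrorRP (typing defect), avoided by using the repaired
DiagonalMirrorRPR.

RANKED CRUXES. #2 CurvatureSandwichBound (crux) — (Σ) for every compact simple G, r, sch and
one-species S₁ with W1 r sch S₁, RP in the eight planar frames, the planar cone and the soft
two-point kernel (η > 0 below |x|⁻¹⁰): for the e₀-reconstruction of S₁ AND of its 45° pull-back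
there are μ < 4 and C with ‖Ψ(f₁ ⊗ T_{(2u+v)e₀}W)‖ ≤ C·Mg·(Mh+Mh')·(u^{−μ}+v^{−μ})·‖Ψ(W)‖ for all 0
< u, v ≤ 1, f₁ = g(x₀,x₁)hh(x₂,x₃) with g supported in the time window [u,2u], ∫|g| ≤ Mg, ∫|hh| ≤
Mh, |hh| ≤ Mh', all time-ordered W (the registered stub_sandwichBound of crux 14999's line with the
45° frame R named by its coordinates (Rx)₀ = cos(π/4)x₀ + sin(π/4)x₁, (Rx)₁ = −sin(π/4)x₀ +
cos(π/4)x₁, (Rx)₂,₃ = x₂,₃ instead of Literature's `planeRot 0 (π/4)` — restated stmt-17720 →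
stmt-18372 at cone repair rev 3, `sigmaOld_iff_sigmaNew` in evidence Bridge.lean; its vacuum row is
K with μ₀ = 4 − η/2). [deps: CurvatureKernelBound] [difficulty: XL] (why it might fail: It is a
k-uniform UV operator bound on tr F² of the Wilson limit entering only through the tie; the 45° row
needs the DIAGONAL transfer matrix; a gapped Wilson limit whose tr F² four-point function scales
with dimension ≥ 5 obeys W1, K and refutes it.) [FredenhagenHertel1981, GlimmJaffe1987,
OsterwalderSchrader1975, LuscherWeisz1985, Balaban1989LargeFieldII, KravchukQiaoRychkov2021]
#3 TemperedCurvatureMoments (crux) — (T) for every compact simple G, r, sch, S₁ with W1, eight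
frames, cone, and every degree n ≥ 1: lattice densities D_k on the scheme's tori, TEMPERED at
injective multi-sites uniformly in k ≥ k₀ — |D_k(x)| ≤ C(1+‖a_k x‖)^N(1+Σ_{i≠j}‖a_k xᵢ − a_k
xⱼ‖⁻¹)^N — whose Riemann sums converge to S₁ n on every off-diagonal real tensor (verbatim the
registered stub_temperedLatticeApproximants of cruxes 9663/11686/14999; ∃ D absorbs the junk
schemes, the intended witness is the true renormalised moment density). [difficulty: XL] (why it
might fail: W1 pins neither asymptotic freedom nor the scaling of c_k: a gapped Wilson limit whose
renormalised tr F² moment densities blow up faster than any power at short physical distance (or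
grow super-polynomially) satisfies W1 and violates it; only c ≡ 0 / β = 0 inhabitants are
certified.) [OsterwalderSchrader1975, Balaban1989LargeFieldII, MagnenRivasseauSeneor1993,
JaffeWitten2000, OsterwalderSeiler1978]
#4 CurvatureKernelBound (crux) — (K) shared verbatim with MirrorModularBoosts / PencilRigidity /
CertificationLength (stmt-QuantumFields-11687): the two-point function of the curvature channel on
⁰𝒮 is a real kernel K(x₀−x₁), continuous off 0, with |K(x)| ≤ C(1+|x|^(η−10)), η > 0. [deps:
WeakCouplingHypercubicLimit] [difficulty: open-problem] (why it might fail: W₁ fixes neither the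
scaling of c_k nor asymptotic freedom: the singularity ORDER (below |x|⁻¹⁰) and off-origin
continuity of the renormalised tr F² kernel are outputs of the open UV construction; a gapped Wilson
limit with kernel ~|x|⁻¹⁰ obeys W₁ and violates it.) [JaffeWitten2000, Balaban1989LargeFieldII,
MagnenRivasseauSeneor1993, KravchukQiaoRychkov2021, LuscherWeisz1985, OsterwalderSeiler1978]
#5 DiagonalMirrorRPR (crux) — (D) shared verbatim with MirrorModularBoosts / PencilRigidity
(stmt-QuantumFields-10604): the curvature channel S₁ of a Wilson limit carrying W₁ is reflection
positive in pull-back form across the four oriented diagonal mirrors x₀ = ±x₁. [deps: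
WeakCouplingHypercubicLimit] [difficulty: L] (why it might fail: No finite 4-torus has the diagonal
mirror pair; free-box diagonal RP of Wilson's plaquette action must survive the torus limit by
b.c.-insensitivity from the uniform gap, unproved.) [FrohlichIsraelLiebSimon1978,
OsterwalderSeiler1978, Seiler1982, JaffeWitten2000, MontvayMunster1994]
#6 WeakCouplingHypercubicLimit (crux) — (H⁺) shared verbatim with MirrorModularBoosts
(stmt-QuantumFields-16154 ≡ CoincidenceRotationBootstrap.HypercubicLimit): the weak-coupling
existence leg — for every compact simple G a Wilson scaling limit at β_k → ∞ of all gauge-invariant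
observables with every clause of YangMills except the rotation half of E1 (E0, E0′, E2, E3, E4,
translations, proper hypercubic invariance, tie, non-triviality, non-Gaussianity, continuum and
uniform lattice gap). [difficulty: open-problem] (why it might fail: It is the Millennium
existence-and-gap problem minus rotations at the Gaussian UV fixed point: tightness of renormalised
tr F² correlators as β_k → ∞ (Bałaban stops at UV stability) and a volume-uniform gap are open.)
[JaffeWitten2000, Balaban1989LargeFieldII, BalabanEtAl1984, MagnenRivasseauSeneor1993,
OsterwalderSeiler1978, Seiler1982]
#7 PlanarSpectralCone (crux, PROVED) — (C) MirrorModularBoosts' model-blind planar spectral cone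
(stmt-9664, closed proved by
`Cruxes.PlanarSpectralCone.PositivityDiscToOperatorCone.PlanarSpectralCone_of`), refiled verbatim as
stmt-18313 and consumed by `closes` as a binder exactly as in the parent's deciding theorem (its
proof module's cone carries Wightman/WightmanProofs facts by co-location); closes in one line
through a Theorems file importing this route file. [difficulty: proved] [OsterwalderSchrader1973,
OsterwalderSchrader1975, JarnickiPflug2011, GlimmJaffe1987]
#9 EngineFromPowerCounting (crux-kind rank 9 by the crux-only layer invariant; binder of `closes`) —
THE TYPED SPLIT (lens 3.4 deliverable): T → Σ → MirrorModularBoosts.SoftKernelBoostCovariance, BY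
NAME. PROVED sorry-free in the opener's Sketch.lean (`engine_proof`: Step 0 from T via the landed
stub_dominatedTieLimit p108509 + stub_regular_of_dominated p109000, then the landed
stub_cruxOfInputs p135724; after the Σ restate add R := planeRot 0 (π/4) by `planeRot_coords`,
Bridge.lean); a prover lands it in a Theorems file importing this route file +
…SoftKernelBoostCovarianceOfInputs (cycle-protected: no back-import into the route file).
[difficulty: provable-now] [OsterwalderSchrader1975, Borchers1992]
#9 CurvatureDensities (support) — STEP 0 of the three engines (cruxes 9663 / 11686 / 14999): W1 +
eight frames + cone ⇒ every 𝔖ₙ|⁰𝒮 of the curvature channel is integration against a function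
(NPointRegular). A COROLLARY of T (proved in Sketch.lean, `stepZero_proof`); filed so that the three
registered skeletons can import one landing. [difficulty: provable-now] [OsterwalderSchrader1975,
GlimmJaffe1987]

TWO-LAYER PLAN. Foreseen glued splits (none filed now): Σ ⇐ Σ_lat → Σ_inherit → Σ (a k-uniform
transfer-matrix sandwich bound for the smeared
lattice curvature field at β_k, the Yang–Mills content, plus its soft inheritance by the
OS-reconstructed limit through the
tie); T ⇐ T_{n≤2} → T_{n≥3} → T (degrees ≤ 2 are close to the kernel currency of K and the landed
degree-≤2 tie files of crux
11686; degrees ≥ 3 carry the multi-point temperedness); K may turn out to be the vacuum row of Σ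
plus off-origin continuity
(support SandwichVacuumRow, not filed).

KILL CRITERIA. A Wilson-limit family (β_k → ∞, W1, eight frames, cone, soft kernel) violating Σ as
typed — most cheaply in the 45° frame —
closes the route `refuted:CurvatureSandwichBound` and sends the E1 programme back to crux ideation
on 14999 with the landed
engine as constraint; ¬T (a tied limit with non-tempered densities beyond the ∃ D slack) pivots Step
0 to the continuity
residual of crux 11686's Disproof §7b; ¬K or ¬D are shared kills with MirrorModularBoosts /
PencilRigidity (same repair);
WeakCouplingHypercubicLimit proved elsewhere with full E1 (any UV+IR route reaching YangMills) moots
the route; a tenure split of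
B′ inside MirrorModularBoosts attaching to the same two items supersedes it (close `superseded
--by`).

NOT DECOMPOSED YET. The lattice face of Σ (transfer-matrix sandwich at fixed k, uniform in k) and
its inheritance lemma; the degree split of T;
the vacuum-row lemma K ⇐ Σ + continuity; any decomposition of H⁺ (owned by the HypercubicLimit
leads: UV moment bounds / IR
cold pressure / Z1 / Z3b, registered there) — all layer-2, after a crux closes.

CHEAPEST FALSIFIER. Run the disprover's Gaussian/GFF battery of crux 14999 (Disproof.lean +
Negative/TieLoadBearing) against Σ AS TYPED: in the
generalised-free class Σ ⟺ Δ₂ < 5 (lead's SandwichVetting §2), so any 16-RP coned GFF with soft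
kernel but Σ-violating
45°-frame transfer matrix kills Σ without touching the crux; and check T on the
perverse-renormalisation strong-coupling
schemes of Disproof §5 item 3 (expected: absorbed by ∃ D, witness D ≡ κⁿ). I ran the in-Lean
degenerate case: T holds with
D ≡ 0 on every scheme with c ≡ 0 (bc/T_special.lean), and the split itself is kernel-checked
(Sketch.lean rc 0, 0 sorries).

NUMBERS. Exponents: tr F² canonical dimension 4; first hypercubic-only scalar Σ_μ tr(D_μF_μν)²
dimension 6 (LuscherWeisz1985); anisotropic
W(B₄)-scalar admixture costs dimension ≥ 5; K's threshold |x|⁻¹⁰ ⟺ dimension 5; Σ's slack μ < 4 ⟺ μ₀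
= 4 − η/2 on the vacuum
row; Gaussian class μ = Δ₂ − 1. Items at open: 9 (5 cruxes, 3 supports incl. the proved split, 1
assembly); after the cone repair (revs 1–3): 10 — Σ (restated 18372), T, K, D, H⁺, the certified
binders E (17722, crux-kind r9) and C (18313), support CurvatureDensities, Assembly; import cone 330
→ 74 modules, 13 → 0 unproved named facts. Landed engine:
25 Theorems files on 14999 + 15 on 9663 (p-ids in Cruxes/SoftKernelBoostCovariance/Lines/Sketch.md).

DEFINITION REQUESTS. None: W1, EightFrameRP, PlanarCone
(Theorems.CurvatureBoostCovariance.Negative.Unbundled), NPointRegular, E4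
(Theorems.NPointIsotropy.Negative), OSReconstructionNoE1.fieldVec all exist (Literature's planeRot
is no longer referenced by the route file — the 45° frame is named by coordinates); bib entry
FredenhagenHertel1981 added this session (commit 61f5585dc94f).

Novelty: Searches (2026-08-17): `lit search "pointlike localized fields energy bounds Fredenhagen Hertel"`
and `lit search "restoration of
rotational symmetry lattice gauge theory continuum limit"` (local searchd: connection reset ×3 —
service unavailable, recorded);
`lit search --source openalex …` (HTTP 429, budget exhausted); `lit galaxy search "restoration of
rotational symmetry" --star all`
(13 rows: Montvay–Münster, Rebbi (ed.), Lu–Lähde–Lee–Meißner arXiv:1403.8056 — numerics/EFT, no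
theorem); `lit galaxy search
"pointlike localized fields" --star all` (11: Haag, Halvorson AQFT notes — the FredenhagenHertel1981
H-bound notion);
`lit galaxy search "polynomial energy bounds" --star all` (5: arXiv:2407.18222 OS axioms for unitary
VOAs via energy bounds, 2-D);
`lit galaxy search "Euclidean invariance from reflection positivity" --star all` (0); grounder
g41-0's record on 14999 (KleinLandau1983,
FrohlichOsterwalderSeiler1983 go rotations ⇒ boosts; LangRebbi1982 numerics; galaxy 0 ×2); `lean
search` for planeRot /
OSReconstructionNoE1 / fieldVec / NPointRegular (tree vocabulary located); ledger negatives (4, none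
near).
Nearest prior art found: route-QuantumFields-MirrorModularBoosts itself (parent: same E1 mechanism,
B′ as an XL symmetry crux) and its
crux line Sketch (idea transverse-slack-heat-sandwich; composition p135724); in print
FredenhagenHertel1981 (polynomial H-bounds ⇒
pointlike fields — the form of Σ, no lattice, no rotations) and KleinLandau1983 (Euclidean ⇒
Poincaré und  [refs: 1403.8056, 2407.18222, FredenhagenHertel1981, KleinLandau1983, FrohlichOsterwalderSeiler1983, LangRebbi1982]

Barriers (technique_class: reflection-positivity, uv-power-counting, os-operators): - technique_class: reflection-positivity, uv-power-counting, os-operators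
- Literature.Barriers.QuantumFields.RegularisationDichotomy: evaded as in the parent — no
Euclidean-invariant comparison regulator; E1 comes from sixteen mirrors + cone + UV bounds of ONE
reflection-positive Wilson limit.
- Literature.Barriers.QuantumFields.ImprovedActionPositivityViolation: load-bearing and respected —
the diagonal rays of the engine need the diagonal mirrors of the UNIMPROVED plaquette action (crux
D); improved actions are excluded by design.
- Literature.Barriers.QuantumFields.UVStabilityNonUniqueness: Σ, T, K are UV-stability-CLASS bounds
used only as inputs to a symmetry argument along the Statement's own subsequential scheme;
uniqueness of the limit is never used.
- Literature.Barriers.QuantumFields.PerturbativeInvisibility: nothing is expanded in g; the slack is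
a full power (μ < 4 vs 5), not an asymptotic-freedom logarithm; the gap enters only through W1.
- Literature.Barriers.QuantumFields.FixedCouplingUltralocality: consistent — fixed-β / c ≡ 0 limits
are c-number fields where Σ (μ = 0), T (D ≡ κⁿ) and the conclusion all hold; H⁺'s weak-coupling and
non-triviality clauses exclude them from `closes`.
- Negatives index: 4 entries for the summit; the only YangMills one is the parent's unrepaired
DiagonalMirrorRP (S₁ 0 unconstrained), steered around by filing the repaired DiagonalMirrorRPR
verbatim.

History (route lifecycle, newest last):
- 2026-08-17T02:29:44Z · rev 3: restated CurvatureSandwichBound (stmt-QuantumFields-17720) — cone repair step 2/3 (unit rrepair-QuantumFields-IsotropyFromPowe-d43bba7b): restate crux Σ CurvatureSandwichBound planeRot-FREE — the 45° frame of the (x₀,x₁)- (planner-rrepair-QuantumFields-IsotropyFromPowe-d43bba7b-0)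
- 2026-08-25T15:26:50Z · DORMANT — reconciler: no traction for 7.8 d (last activity item-evidence-added at 2026-08-17T19:18:50Z); parked, not closed — `ledger route dormant route-QuantumFields-Is (operator:999:360706)
- 2026-08-29T09:42:56Z · REACTIVATED — reconciler: reactivated — activity statement-checked at 2026-08-29T08:47:57Z after parking at 2026-08-25T15:26:50Z (operator:999:3799832)
- 2026-08-31T13:59:08Z · rev 6: restated Assembly (stmt-QuantumFields-17724 proved) — FOLD (shape F) IFPC: add WeakCouplingHypercubicLimitRP (dedup onto stmt-QuantumFields-27395) + DROP superseded old D stmt-10604 / old H stmt-16154 (both already (operator:999:345136)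
- 2026-08-31T13:59:08Z · rev 6: dropped stmt-QuantumFields-10604, stmt-QuantumFields-16154 — FOLD (shape F) IFPC: add WeakCouplingHypercubicLimitRP (dedup onto stmt-QuantumFields-27395) + DROP superseded old D stmt-10604 / old H stmt-16154 (both already (operator:999:345136)

sub-problem: YangMills · status: open · opened planner-plan-lens3-QuantumFields-decomp-0 2026-08-17T02:06:40Z · rev 7 · ledger route-QuantumFields-IsotropyFromPowerCounting
GENERATED by the gate from the ledger (D-0016/17). Provers cite these decls: `theorem foo : Summit.QuantumFields.YangMills.Theses.IsotropyFromPowerCounting.<Decl> := …` in Summits/QuantumFields/YangMills/Theorems/<Name>.lean.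
-/

namespace Summit.QuantumFields.YangMills.Theses.IsotropyFromPowerCounting

open scoped BigOperators Topology Manifold Classical MeasureTheory ProbabilityTheory Matrix InnerProductSpace ComplexConjugate ContinuousMap
open Filter Set Function TopologicalSpace MeasureTheory

attribute [summit_statement] _root_.YangMills

-- earlier CurvatureSandwichBound (stmt-QuantumFields-17720, replaced 2026-08-17T02:29:44Z -> stmt-QuantumFields-18372): retired by None — open Literature.MathematicalPhysics.QuantumLattice Literature.MathematicalPhysics.AQFT Literature.MathematicalPhysics.QuantumFieldTheory Literature.Probability.LatticeModels Summit.QuantumFields.YangMills.Theorems.CurvatureBoostCovariance.Negative Summit.QuantumFi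
/-- item stmt-QuantumFields-18372 · crux · rank 2 · open · by planner
why it might fail: It is a k-uniform UV operator bound on tr F² of the Wilson limit entering only through the tie; the 45° row needs the DIAGONAL transfer matrix; a gapped Wilson limit whose tr F² four-point function scales with dimension ≥ 5 obeys W1, K and refutes it.
sources: FredenhagenHertel1981, GlimmJaffe1987, OsterwalderSchrader1975, LuscherWeisz1985, Balaban1989LargeFieldII, KravchukQiaoRychkov2021
[crux] (Σ) for every compact simple G, r, sch and one-species S₁ with W1 r sch S₁, RP in the eight
planar frames, the planar cone and the soft two-point kernel (η > 0 below |x|⁻¹⁰): for the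
e₀-reconstruction of S₁ AND of its 45° pull-back S₁∘R — R the rotation of the (x₀,x₁)-plane named by
its coordinates (Rx)₀ = cos(π/4)x₀ + sin(π/4)x₁, (Rx)₁ = −sin(π/4)x₀ + cos(π/4)x₁, (Rx)₂ = x₂, (Rx)₃
= x₃ (Mathlib-only; = Literature's `planeRot 0 (π/4)`, whose module imports the fact-laden
Wightman.lean — cone repair 2026-08-17, equivalence kernel-checked: evidence Bridge.lean
`sigmaOld_iff_sigmaNew`) — there are μ < 4 and C with ‖Ψ(f₁ ⊗ T_{(2u+v)e₀}W)‖ ≤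
C·Mg·(Mh+Mh')·(u^{−μ}+v^{−μ})·‖Ψ(W)‖ for all 0 < u, v ≤ 1, f₁ = g(x₀,x₁)hh(x₂,x₃) with g supported
in the time window [u,2u], ∫|g| ≤ Mg, ∫|hh| ≤ Mh, |hh| ≤ Mh', all time-ordered W (the registered
stub_sandwichBound of crux 14999's line up to naming the frame; its vacuum row is K with μ₀ = 4 −
η/2). [deps: CurvatureKernelBound] [difficulty: XL] -/
@[route_item "route-QuantumFields-IsotropyFromPowerCounting", crux (experiment := "instrument: oid∕items HELD DO-NOT-STAFF (R652), seat confessed + fixed its read loop; per-item rulings R651∕R654: ⟨11687⟩ v16→v17 4585b6d0 REV-PASS (re…") (source := "director HOURLY-YM l.2157, 2026-09-01")]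
def CurvatureSandwichBound : Prop :=
  open Literature.MathematicalPhysics.QuantumLattice Literature.MathematicalPhysics.AQFT Literature.MathematicalPhysics.QuantumFieldTheory Literature.Probability.LatticeModels Summit.QuantumFields.YangMills.Theorems.CurvatureBoostCovariance.Negative Summit.QuantumFields.YangMills.Theorems.NPointIsotropy.Negative in ∀ (G : Type) [Group G] [TopologicalSpace G] [IsTopologicalGroup G] [CompactSpace G] [MeasurableSpace G] [BorelSpace G], IsCompactSimpleLieGroup G → ∀ (r : LatticeRep G) (sch : SpeciesScheme (YMSpecies G)) (S₁ : SchwingerFamily E4), W1 r sch S₁ → EightFrameRP S₁ → PlanarCone S₁ → (∃ (K : E4 → ℝ) (C η : ℝ), 0 < η ∧ ContinuousOn K {x : E4 | x ≠ 0} ∧ (∀ x : E4, x ≠ 0 → |K x| ≤ C * (1 + ‖x‖ ^ (η - 10))) ∧ ∀ F : SchwartzMap (Fin 2 → E4) ℂ, IsOffDiagonal F → MeasureTheory.Integrable (fun x : Fin 2 → E4 => (K (x 0 - x 1) : ℂ) * F x) ∧ S₁ 2 F = ∫ x : Fin 2 → E4, (K (x 0 - x 1) : ℂ) * F x) → (∀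 (h : OSReconstructionNoE1 S₁.toLabelled), ∃ μ C : ℝ, μ < 4 ∧ (∀ (u v : ℝ), 0 < u → 0 < v → u ≤ 1 → v ≤ 1 → ∀ (f₁ : SchwartzMap (Fin 1 → E4) ℂ) (g hh : ℝ × ℝ → ℂ) (Mg Mh Mh' : ℝ), (∀ x : Fin 1 → E4, f₁ x = g (x 0 0, x 0 1) * hh (x 0 2, x 0 3)) → (∀ p : ℝ × ℝ, g p ≠ 0 → u ≤ p.1 ∧ p.1 ≤ 2 * u) → MeasureTheory.Integrable g → (∫ p, ‖g p‖) ≤ Mg → MeasureTheory.Integrable hh → (∫ p, ‖hh p‖) ≤ Mh → (∀ p, ‖hh p‖ ≤ Mh') → ∀ (n : ℕ) (W : SchwartzMap (Fin n → E4) ℂ) (hW : IsTimeOrdered W) (hFW : IsTimeOrdered (SchwartzMap.appendTensor f₁ (translateMulti ((2 * u + v) • EuclideanSpace.single 0 1) W))), ‖h.fieldVec (1 + n) (fun _ => ()) (SchwartzMap.appendTensor f₁ (translateMulti ((2 * u + v) • EuclideanSpace.single 0 1) W)) hFW‖ ≤ C * Mg * (Mh + Mh') * (u ^ (-μ) + v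 ^ (-μ)) * ‖h.fieldVec n (fun _ => ()) W hW‖)) ∧ (∀ (R : E4 ≃ₗᵢ[ℝ] E4), (∀ x : E4, R x 0 = Real.cos (Real.pi / 4) * x 0 + Real.sin (Real.pi / 4) * x 1 ∧ R x 1 = -Real.sin (Real.pi / 4) * x 0 + Real.cos (Real.pi / 4) * x 1 ∧ R x 2 = x 2 ∧ R x 3 = x 3) → ∀ (h' : OSReconstructionNoE1 (SchwingerFamily.toLabelled (fun n => (S₁ n).comp (linActMulti R)))), ∃ μ C : ℝ, μ < 4 ∧ (∀ (u v : ℝ), 0 < u → 0 < v → u ≤ 1 → v ≤ 1 → ∀ (f₁ : SchwartzMap (Fin 1 → E4) ℂ) (g hh : ℝ × ℝ → ℂ) (Mg Mh Mh' : ℝ), (∀ x : Fin 1 → E4, f₁ x = g (x 0 0, x 0 1) * hh (x 0 2, x 0 3)) → (∀ p : ℝ × ℝ, g p ≠ 0 → u ≤ p.1 ∧ p.1 ≤ 2 * u) → MeasureTheory.Integrable g → (∫ p, ‖g p‖) ≤ Mg → MeasureTheory.Integrable hh → (∫ p, ‖hh p‖) ≤ Mh → (∀ p, ‖hh p‖ ≤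 Mh') → ∀ (n : ℕ) (W : SchwartzMap (Fin n → E4) ℂ) (hW : IsTimeOrdered W) (hFW : IsTimeOrdered (SchwartzMap.appendTensor f₁ (translateMulti ((2 * u + v) • EuclideanSpace.single 0 1) W))), ‖h'.fieldVec (1 + n) (fun _ => ()) (SchwartzMap.appendTensor f₁ (translateMulti ((2 * u + v) • EuclideanSpace.single 0 1) W)) hFW‖ ≤ C * Mg * (Mh + Mh') * (u ^ (-μ) + v ^ (-μ)) * ‖h'.fieldVec n (fun _ => ()) W hW‖))

/-- item stmt-QuantumFields-17721 · crux · rank 3 · open · by planner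
why it might fail: W1 pins neither asymptotic freedom nor the scaling of c_k: a gapped Wilson limit whose renormalised tr F² moment densities blow up faster than any power at short physical distance (or grow super-polynomially) satisfies W1 and violates it; only c ≡ 0 / β = 0 inhabitants are certified.
sources: OsterwalderSchrader1975, Balaban1989LargeFieldII, MagnenRivasseauSeneor1993, JaffeWitten2000, OsterwalderSeiler1978
[crux] (T) for every compact simple G, r, sch, S₁ with W1, eight frames, cone, and every degree n ≥
1: lattice densities D_k on the scheme's tori, TEMPERED at injective multi-sites uniformly in k ≥ k₀
— |D_k(x)| ≤ C(1+‖a_k x‖)^N(1+Σ_{i≠j}‖a_k xᵢ − a_k xⱼ‖⁻¹)^N — whose Riemann sums converge to S₁ n on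
every off-diagonal real tensor (verbatim the registered stub_temperedLatticeApproximants of cruxes
9663/11686/14999; ∃ D absorbs the junk schemes, the intended witness is the true renormalised moment
density). [difficulty: XL] -/
@[route_item "route-QuantumFields-IsotropyFromPowerCounting", crux (experiment := "instrument: nfessed + fixed its read loop; per-item rulings R651∕R654: ⟨11687⟩ v16→v17 4585b6d0 REV-PASS (registration worded) · ⟨18372⟩ v5→v6 3460a91f…") (source := "director HOURLY-YM l.2157, 2026-09-01")]
def TemperedCurvatureMoments : Prop :=
  open Literature.MathematicalPhysics.QuantumLattice Literature.MathematicalPhysics.AQFT Literature.MathematicalPhysics.QuantumFieldTheory Literature.Probability.LatticeModels Summit.QuantumFields.YangMills.Theorems.CurvatureBoostCovariance.Negative Summit.QuantumFields.YangMills.Theorems.NPointIsotropy.Negative in ∀ (G : Type) [Group G] [TopologicalSpace G] [IsTopologicalGroup G] [CompactSpace G] [MeasurableSpace G] [BorelSpace G], IsCompactSimpleLieGroup G → ∀ (r : LatticeRep G) (sch : SpeciesScheme (YMSpecies G)) (S₁ : SchwingerFamily E4), W1 r sch S₁ → EightFrameRP S₁ → PlanarCone S₁ → ∀ n : ℕ,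 0 < n → ∃ (D : ℕ → (Fin n → Site 4) → ℝ) (C : ℝ) (N k₀ : ℕ), 0 < C ∧ (∀ k : ℕ, k₀ ≤ k → ∀ x : Fin n → Site 4, (∀ i, x i ∈ box 4 (sch.L k)) → Function.Injective x → |D k x| ≤ C * (1 + ‖fun i => sch.a k • siteToE (x i)‖) ^ N * (1 + ∑ i, ∑ j ∈ Finset.univ.erase i, ‖sch.a k • siteToE (x i) - sch.a k • siteToE (x j)‖⁻¹) ^ N) ∧ ∀ (f : Fin n → SchwartzMap E4 ℝ) (F : SchwartzMap (Fin n → E4) ℂ), IsTensorOf F (fun i => ofRealTest (f i)) → IsOffDiagonal F → Filter.Tendsto (fun k => (((sch.a k ^ 4) ^ n * ∑ x ∈ Fintype.piFinset (fun _ : Fin n => box 4 (sch.L k)), (∏ i, f i (sch.a k • siteToE (x i))) * D k x : ℝ) : ℂ)) Filter.atTop (nhds (S₁ n F))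

/-- item stmt-QuantumFields-11687 · crux · rank 4 · open · by planner
why it might fail: W₁ fixes neither the scaling of c_k nor asymptotic freedom: the singularity ORDER (below |x|⁻¹⁰) and off-origin continuity of the renormalised tr F² kernel are outputs of the open UV construction; a gapped Wilson limit with kernel ~|x|⁻¹⁰ obeys W₁ and violates it.
sources: JaffeWitten2000, Balaban1989LargeFieldII, MagnenRivasseauSeneor1993, KravchukQiaoRychkov2021, LuscherWeisz1985, OsterwalderSeiler1978
[crux] card K4 (the only UV datum; tr F² has dimension 4 < 5): for every compact simple G, r, sch
and one-species S₁ carrying W₁, there are a REAL kernel K : ℝ⁴ → ℝ, continuous on ℝ⁴∖0, and C, η > 0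
with |K(x)| ≤ C(1 + |x|^(η−10)) (expected |x|⁻⁸·log^γ near 0; bounded at infinity by clustering)
such that for every off-diagonal two-point test function F the integrand K(x₀−x₁)F(x₀,x₁) is
integrable and S₁ 2 F = ∫ K(x₀ − x₁) F(x₀,x₁) dx₀dx₁. Reality is the limit of the real lattice
correlations; continuity off 0 is the joint regularity the 16 Laplace representations suggest.
Degenerate inhabitants of W₁ (zero scheme: K = 0; constant-field limits: K = κ²) satisfy it. [deps:
HypercubicLimit] [difficulty: open-problem] -/
@[route_item "route-QuantumFields-IsotropyFromPowerCounting", crux]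
def CurvatureKernelBound : Prop :=
  open Literature.MathematicalPhysics.QuantumLattice Literature.MathematicalPhysics.AQFT Literature.MathematicalPhysics.QuantumFieldTheory in let E := EuclideanSpace ℝ (Fin 4); ∀ (G : Type) [Group G] [TopologicalSpace G] [IsTopologicalGroup G] [CompactSpace G], IsCompactSimpleLieGroup G → letI : MeasurableSpace G := borel G; haveI : BorelSpace G := ⟨rfl⟩; let W₁ := fun (r : LatticeRep G) (sch : SpeciesScheme (YMSpecies G)) (S₁ : SchwingerFamily E) => ((∀ (n : ℕ), n ≠ 0 → ∀ (f : Fin n → SchwartzMap (E) ℝ) (F : SchwartzMap (Fin n → E) ℂ), IsTensorOf F (fun i => ofRealTest (f i)) → IsOffDiagonal F → Filter.Tendsto (fun k : ℕ => ((latticeSchwinger r.ρ sch (fun s => s.F) k n (fun _ => r.curvature) f : ℝ) : ℂ)) Filter.atTop (nhds (S₁ n F))) ∧ (S₁.toLabelled.IsNormalized ∧ S₁.toLabelled.IsHermitian ∧ S₁.toLabelled.HasLinearGrowth ∧ S₁.toLabelled.IsReflectionPositive ∧ S₁.toLabelled.IsSymmetric ∧ S₁.toLabelled.HasClusterProperty)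 ∧ (∀ (n : ℕ) (a : E) (F : SchwartzMap (Fin n → E) ℂ), IsOffDiagonal F → S₁ n (translateMulti a F) = S₁ n F) ∧ (∀ (R : E ≃ₗᵢ[ℝ] E), LinearMap.det (R.toLinearEquiv : E →ₗ[ℝ] E) = 1 → (∀ i : Fin 4, ∃ j : Fin 4, R (EuclideanSpace.single i 1) = EuclideanSpace.single j 1 ∨ R (EuclideanSpace.single i 1) = -EuclideanSpace.single j 1) → ∀ (n : ℕ) (F : SchwartzMap (Fin n → E) ℂ), IsOffDiagonal F → S₁ n (linActMulti R F) = S₁ n F) ∧ (∃ Δ : ℝ, 0 < Δ ∧ S₁.toLabelled.HasMassGap Δ ∧ HasLatticeMassGap r sch Δ)); ∀ (r : LatticeRep G) (sch : SpeciesScheme (YMSpecies G)) (S₁ : SchwingerFamily E), W₁ r sch S₁ → ∃ (K : E → ℝ) (C η : ℝ), 0 < η ∧ ContinuousOn K {x : E | x ≠ 0} ∧ (∀ x : E, x ≠ 0 → |K x| ≤ C * (1 + ‖x‖ ^ (η - 10))) ∧ ∀ F : SchwartzMap (Fin 2 → E) ℂ, IsOffDiagonal F → MeasureTheory.Integrable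 (fun x : Fin 2 → E => (K (x 0 - x 1) : ℂ) * F x) ∧ S₁ 2 F = ∫ x : Fin 2 → E, (K (x 0 - x 1) : ℂ) * F x

/-- item stmt-QuantumFields-27395 · crux · rank 6 · open · by operator
why it might fail: It is the 4-d YM construction at weak coupling with a volume-uniform gap (tightness + IR control open; Bałaban stops at UV stability) + diagonal RP of the limit: no finite straight 4-torus carries the diagonal mirror pair, so it needs b.c.-insensitivity / 45°-universality of the witness — unproved.
sources: JaffeWitten2000, Balaban1989LargeFieldII, MagnenRivasseauSeneor1993, OsterwalderSeiler1978, FrohlichIsraelLiebSimon1978, Seiler1982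
[crux] (H_RP — the existence leg at weak coupling WITH diagonal-frame reflection positivity AT ITS
OWN WITNESS; shape F = FOLD of director-ym O4 WORD 1, 2026-08-31; ADDED beside the old crux
`WeakCouplingHypercubicLimit` (stmt-QuantumFields-16154), which stays defined and becomes an aside):
for every compact simple G there exist a lattice representation r, a species scheme sch with
sch.HasWeakCouplingLimit (β_k = 2/g₀² → ∞) and a labelled Schwinger family S on ℝ⁴ such that (NEW
CONJUNCT) the curvature channel n ↦ S n (curvature,…,curvature) is reflection positive in pull-back
form n ↦ S n ∘ linActMulti R for every frame R with R e₀ = a e₀ + b e₁, a² = b² = ½ (the four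
oriented diagonal mirrors x₀ = ±x₁ of THIS witness — not of every W₁ datum), AND all of today's
HypercubicLimit clauses (E0, E0′, E2, E3, E4, translations and proper-hypercubic invariance on ⁰𝒮,
convergence of Wilson's renormalised strings along sch to S, non-triviality and non-Gaussianity of
the curvature species, Δ > 0 with S.HasMassGap Δ and HasLatticeMassGap r sch Δ). H_RP ⟹ H_old (drop
the conjunct); YangMills ⟹ H_RP (kit probe OnPathF: the summit's full SO(4) covariance transports E2
to the diagonal frames — the -/
@[route_item "route-QuantumFields-IsotropyFromPowerCounting", crux]
def WeakCouplingHypercubicLimitRP : Prop :=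
  open Literature.MathematicalPhysics.QuantumLattice Literature.MathematicalPhysics.AQFT Literature.MathematicalPhysics.QuantumFieldTheory in let E := EuclideanSpace ℝ (Fin 4); ∀ (G : Type) [Group G] [TopologicalSpace G] [IsTopologicalGroup G] [CompactSpace G], IsCompactSimpleLieGroup G → letI : MeasurableSpace G := borel G; haveI : BorelSpace G := ⟨rfl⟩; ∃ (r : LatticeRep G) (sch : SpeciesScheme (YMSpecies G)) (S : LabelledSchwingerFamily (YMSpecies G) (E)), sch.HasWeakCouplingLimit ∧ (∀ (R : E ≃ₗᵢ[ℝ] E) (a b : ℝ), a ^ 2 = 1 / 2 → b ^ 2 = 1 / 2 → R (EuclideanSpace.single 0 1) = a • EuclideanSpace.single 0 1 + b • EuclideanSpace.single 1 1 → (SchwingerFamily.toLabelled (fun n => (S n (fun _ => r.curvature)).comp (linActMulti R))).IsReflectionPositive) ∧ (S.IsNormalized ∧ S.IsHermitian ∧ S.HasLinearGrowth ∧ S.IsReflectionPositive ∧ S.IsSymmetric ∧ S.HasClusterProperty ∧ (∀ (n : ℕ) (k : Fin n → YMSpecies G) (a : E) (F : SchwartzMap (Fin n → E) ℂ), IsOffDiagonal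 F → S n k (translateMulti a F) = S n k F) ∧ (∀ (n : ℕ) (k : Fin n → YMSpecies G) (R : E ≃ₗᵢ[ℝ] E), LinearMap.det (R.toLinearEquiv : E →ₗ[ℝ] E) = 1 → (∀ i : Fin 4, ∃ j : Fin 4, R (EuclideanSpace.single i 1) = EuclideanSpace.single j 1 ∨ R (EuclideanSpace.single i 1) = -EuclideanSpace.single j 1) → ∀ F : SchwartzMap (Fin n → E) ℂ, IsOffDiagonal F → S n k (linActMulti R F) = S n k F)) ∧ (∀ (n : ℕ), n ≠ 0 → ∀ (σ : Fin n → YMSpecies G) (f : Fin n → SchwartzMap (E) ℝ) (F : SchwartzMap (Fin n → E) ℂ), IsTensorOf F (fun i => ofRealTest (f i)) → IsOffDiagonal F → Filter.Tendsto (fun k : ℕ => ((latticeSchwinger r.ρ sch (fun s => s.F) k n σ f : ℝ) : ℂ)) Filter.atTop (nhds (S n σ F))) ∧ (∃ (F₁ G₁ : SchwartzMap (Fin 1 → E) ℂ) (H₁ : SchwartzMap (Fin (1 + 1) → E) ℂ), IsTimeOrdered F₁ ∧ IsTimeOrdered G₁ ∧ IsAppendTensorOf H₁ (osAdjoint F₁)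 G₁ ∧ S (1 + 1) (fun _ => r.curvature) H₁ ≠ S 1 (fun _ => r.curvature) (osAdjoint F₁) * S 1 (fun _ => r.curvature) G₁) ∧ (∃ (f g h : SchwartzMap (E) ℂ) (Ffgh : SchwartzMap (Fin 3 → E) ℂ) (Fgh Ffh Ffg : SchwartzMap (Fin 2 → E) ℂ) (Ff Fg Fh : SchwartzMap (Fin 1 → E) ℂ), IsTensorOf Ffgh ![f, g, h] ∧ IsOffDiagonal Ffgh ∧ IsTensorOf Fgh ![g, h] ∧ IsTensorOf Ffh ![f, h] ∧ IsTensorOf Ffg ![f, g] ∧ IsTensorOf Ff ![f] ∧ IsTensorOf Fg ![g] ∧ IsTensorOf Fh ![h] ∧ S 3 (fun _ => r.curvature) Ffgh - S 1 (fun _ => r.curvature) Ff * S 2 (fun _ => r.curvature) Fgh - S 1 (fun _ => r.curvature) Fg * S 2 (fun _ => r.curvature) Ffh - S 1 (fun _ => r.curvature) Fh * S 2 (fun _ => r.curvature) Ffg + 2 * (S 1 (fun _ => r.curvature) Ff * S 1 (fun _ => r.curvature) Fg * S 1 (fun _ => r.curvature) Fh) ≠ 0) ∧ (∃ Δ : ℝ,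 0 < Δ ∧ S.HasMassGap Δ ∧ HasLatticeMassGap r sch Δ)

/-- item stmt-QuantumFields-18313 · crux · rank 7 · closed · proved by Summit.QuantumFields.YangMills.Theorems.isotropyFromPowerCounting_planarSpectralCone_proof @ e83fe2a10a46 (prover) · by planner
why it might fail: Proved (stmt-QuantumFields-9664, PlanarSpectralCone_of); residual risk nil. Historical risk: no E1 and RP only on frame-time-ordered supports — multi-time analyticity and density of cone-ordered vectors from E0' alone (OS II sans rotations); axis RP alone fails (product-OU).
sources: OsterwalderSchrader1973, OsterwalderSchrader1975, JarnickiPflug2011, GlimmJaffe1987, doi:10.1007/bf01611501, arXiv:1201.6003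
[crux] (C) SHARED VERBATIM with MirrorModularBoosts (stmt-QuantumFields-9664, PROVED by
Summit.QuantumFields.YangMills.Cruxes.PlanarSpectralCone.PositivityDiscToOperatorCone.PlanarSpectralCone_of,
Theorems/MirrorModularBoostsPlanarSpectralCone.lean): the planar spectral cone spec(H,P₁) ⊂ {E ≥
|p₁|} after e₀-reconstruction of a one-species Schwinger family on ℝ⁴ with E0', E3, translations on
⁰𝒮 and reflection positivity in the eight frames of the (x₀,x₁)-plane, typed as a holomorphic
contraction family on {|Im β| < Re ζ}. Consumed by `closes` as a binder exactly as in the parent's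
deciding theorem: its proof module's import cone carries unproved Literature facts (Wightman.lean,
WightmanProofs.lean) by module co-location, so the proof is not imported into this route file (cone
repair 2026-08-17). [difficulty: proved] -/
@[route_item "route-QuantumFields-IsotropyFromPowerCounting", crux]
def PlanarSpectralCone : Prop :=
  open Literature.MathematicalPhysics.QuantumLattice Literature.MathematicalPhysics.AQFT Literature.MathematicalPhysics.QuantumFieldTheory in let E := EuclideanSpace ℝ (Fin 4); ∀ (S : SchwingerFamily E), S.toLabelled.HasLinearGrowth → S.toLabelled.IsSymmetric → (∀ (n : ℕ) (a : E) (F : SchwartzMap (Fin n → E) ℂ), IsOffDiagonal F → S n (translateMulti a F) = S n F) → (∀ (R : E ≃ₗᵢ[ℝ] E) (a b : ℝ), a ^ 2 + b ^ 2 = 1 → (a = 0 ∨ b = 0 ∨ a ^ 2 = b ^ 2) → R (EuclideanSpace.single 0 1) = a • EuclideanSpace.single 0 1 + b • EuclideanSpace.single 1 1 → (SchwingerFamily.toLabelled (fun n => (S n).comp (linActMulti R))).IsReflectionPositive) → ∀ (n m : ℕ) (F : SchwartzMap (Fin n → E) ℂ) (G : SchwartzMap (Fin m → E) ℂ), IsTimeOrdered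 F → IsTimeOrdered G → ∃ Φ : ℂ × ℂ → ℂ, DifferentiableOn ℂ Φ {w : ℂ × ℂ | |w.2.im| < w.1.re} ∧ (∀ (t b : ℝ), 0 < t → ∀ H : SchwartzMap (Fin (n + m) → E) ℂ, IsAppendTensorOf H (osAdjoint F) (translateMulti (t • EuclideanSpace.single 0 1 + b • EuclideanSpace.single 1 1) G) → Φ ((t : ℂ), (b : ℂ)) = S (n + m) H) ∧ (∀ w ∈ {w : ℂ × ℂ | |w.2.im| < w.1.re}, ∀ (HF : SchwartzMap (Fin (n + n) → E) ℂ) (HG : SchwartzMap (Fin (m + m) → E) ℂ), IsAppendTensorOf HF (osAdjoint F) F → IsAppendTensorOf HG (osAdjoint G) G → ‖Φ w‖ ^ 2 ≤ ‖S (n + n) HF‖ * ‖S (m + m) HG‖)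

-- `PlanarSpectralCone` holds: proved by `Summit.QuantumFields.YangMills.Theorems.isotropyFromPowerCounting_planarSpectralCone_proof` @ e83fe2a10a46 (its module imports this route file, so no `_holds` link can be stated here).

/-- item stmt-QuantumFields-17722 · crux · rank 9 · closed · proved by Summit.QuantumFields.YangMills.Theorems.SoftKernelBoostCovariance.Sketch.engineFromPowerCounting_proof @ b25bca9087a2 (prover) · by planner
why it might fail: Cannot fail mathematically: T → Σ → B′ is kernel-checked (opener's Sketch.lean engine_proof over landed p108509, p109000, p135724). Crux-kind only by the crux-only-closes layer invariant: its proof module carries 13 unproved Literature facts by co-location, so closes takes it as a binder.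
sources: OsterwalderSchrader1975, Borchers1992, FredenhagenHertel1981
[support] THE TYPED SPLIT (lens 3.4 deliverable): T → Σ →
MirrorModularBoosts.SoftKernelBoostCovariance, BY NAME. PROVED sorry-free in the planner's
Sketch.lean (`engine_proof`: Step 0 from T via the landed stub_dominatedTieLimit p108509 +
stub_regular_of_dominated p109000, then the landed stub_cruxOfInputs p135724); a prover lands it
verbatim. [difficulty: provable-now] -/
@[route_item "route-QuantumFields-IsotropyFromPowerCounting", crux]
def EngineFromPowerCounting : Prop :=
  TemperedCurvatureMoments → CurvatureSandwichBound → Summit.QuantumFields.YangMills.Theses.MirrorModularBoosts.SoftKernelBoostCovariance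

-- `EngineFromPowerCounting` holds: proved by `Summit.QuantumFields.YangMills.Theorems.SoftKernelBoostCovariance.Sketch.engineFromPowerCounting_proof` @ b25bca9087a2 (its module imports this route file, so no `_holds` link can be stated here).

/-- item stmt-QuantumFields-10604 · aside · rank 5 · open · by planner
[crux] (D) YM-SPECIFIC — REPAIRED DiagonalMirrorRP (stmt-QuantumFields-9665, refuted-misstated by
Summit.QuantumFields.YangMills.Theorems.MirrorModularBoostsDiagonalMirrorRP_refuted: as typed S₁ 0
was unconstrained — lattice convergence was asked only for n ≠ 0 and no E0 — so S₁ 0 := −δ over the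
zero scheme made the degree-0 term of E2 equal −1). Now stated over exactly the curvature-channel
package W₁ that CurvatureChannel produces and CurvatureBoostCovariance consumes (convergence of the
renormalised action-density strings to S₁ on ⁰𝒮 along sch; E0 normalisation + hermiticity, E0', E2
along e₀, E3, E4 of S₁.toLabelled; translations and proper signed permutations on ⁰𝒮; a continuum
gap and the uniform lattice gap HasLatticeMassGap r sch Δ, Δ > 0): for every compact simple G,
lattice representation r, scheme sch and one-species family S₁ with W₁ r sch S₁, S₁ is reflection
positive in pull-back form for every frame R with R e₀ = a e₀ + b e₁, a² = b² = 1/2 (the four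
oriented diagonal mirrors x₀ = ±x₁ of the (x₀,x₁)-plane). E0 pins the degree-0 term (|Σ c_j|² ≥ 0)
and every value the conclusion inspects is determined by W₁ (S₁ 0 by E0; S₁ n, n ≥ 1, only on ⁰𝒮 —
θF*⊗G of time-ordered F -/
@[route_item "route-QuantumFields-IsotropyFromPowerCounting"]
def DiagonalMirrorRPR : Prop :=
  open Literature.MathematicalPhysics.QuantumLattice Literature.MathematicalPhysics.AQFT Literature.MathematicalPhysics.QuantumFieldTheory in let E := EuclideanSpace ℝ (Fin 4); ∀ (G : Type) [Group G] [TopologicalSpace G] [IsTopologicalGroup G] [CompactSpace G], IsCompactSimpleLieGroup G → letI : MeasurableSpace G := borel G; haveI : BorelSpace G := ⟨rfl⟩; let W₁ := fun (r : LatticeRep G) (sch : SpeciesScheme (YMSpecies G)) (S₁ : SchwingerFamily E) => ((∀ (n : ℕ), n ≠ 0 → ∀ (f : Fin n → SchwartzMap (E) ℝ) (F : SchwartzMap (Fin n → E) ℂ), IsTensorOf F (fun i => ofRealTest (f i)) → IsOffDiagonal F → Filter.Tendsto (fun k : ℕ => ((latticeSchwinger r.ρ sch (fun s => s.F) k n (fun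 _ => r.curvature) f : ℝ) : ℂ)) Filter.atTop (nhds (S₁ n F))) ∧ (S₁.toLabelled.IsNormalized ∧ S₁.toLabelled.IsHermitian ∧ S₁.toLabelled.HasLinearGrowth ∧ S₁.toLabelled.IsReflectionPositive ∧ S₁.toLabelled.IsSymmetric ∧ S₁.toLabelled.HasClusterProperty) ∧ (∀ (n : ℕ) (a : E) (F : SchwartzMap (Fin n → E) ℂ), IsOffDiagonal F → S₁ n (translateMulti a F) = S₁ n F) ∧ (∀ (R : E ≃ₗᵢ[ℝ] E), LinearMap.det (R.toLinearEquiv : E →ₗ[ℝ] E) = 1 → (∀ i : Fin 4, ∃ j : Fin 4, R (EuclideanSpace.single i 1) = EuclideanSpace.single j 1 ∨ R (EuclideanSpace.single i 1) = -EuclideanSpace.single j 1) → ∀ (n : ℕ) (F : SchwartzMap (Fin n → E) ℂ), IsOffDiagonal F → S₁ n (linActMulti R F) = S₁ n F) ∧ (∃ Δ : ℝ, 0 < Δ ∧ S₁.toLabelled.HasMassGap Δ ∧ HasLatticeMassGap r sch Δ)); ∀ (r : LatticeRep G) (sch : SpeciesScheme (YMSpecies G)) (S₁ : SchwingerFamily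 E), W₁ r sch S₁ → ∀ (R : E ≃ₗᵢ[ℝ] E) (a b : ℝ), a ^ 2 = 1 / 2 → b ^ 2 = 1 / 2 → R (EuclideanSpace.single 0 1) = a • EuclideanSpace.single 0 1 + b • EuclideanSpace.single 1 1 → (SchwingerFamily.toLabelled (fun n => (S₁ n).comp (linActMulti R))).IsReflectionPositive

/-- item stmt-QuantumFields-16154 · aside · rank 6 · open · by planner
[crux] the EXISTENCE LEG (imported complement, = YangMills minus rotations under the re-typed
statement p116790; `YangMills → HypercubicLimit` is proved in the repair planner's Sketch.lean): for
every compact simple G there are r, a sequential scheme sch AT WEAK COUPLING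
(sch.HasWeakCouplingLimit: β_k = 2/g₀² → ∞) and a labelled Schwinger family S on ℝ⁴ over YMSpecies G
with E0 (normalisation, hermiticity), E0', E2, E3, E4, translation invariance and proper-hypercubic
invariance on ⁰𝒮, the IsYangMillsFor convergence of Wilson's lattice theory along sch to S,
non-triviality and non-Gaussianity of the curvature species, and Δ > 0 with S.HasMassGap Δ and
HasLatticeMassGap r sch Δ. Every UV+IR route (Bałaban RG, flow-line state space, finite-size
criterion, curvature/LSI closers) outputs exactly this; this route adds nothing to it and bets on
them. [difficulty: open-problem] -/
@[route_item "route-QuantumFields-IsotropyFromPowerCounting"]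
def WeakCouplingHypercubicLimit : Prop :=
  open Literature.MathematicalPhysics.QuantumLattice Literature.MathematicalPhysics.AQFT Literature.MathematicalPhysics.QuantumFieldTheory in let E := EuclideanSpace ℝ (Fin 4); ∀ (G : Type) [Group G] [TopologicalSpace G] [IsTopologicalGroup G] [CompactSpace G], IsCompactSimpleLieGroup G → letI : MeasurableSpace G := borel G; haveI : BorelSpace G := ⟨rfl⟩; ∃ (r : LatticeRep G) (sch : SpeciesScheme (YMSpecies G)) (S : LabelledSchwingerFamily (YMSpecies G) (E)), sch.HasWeakCouplingLimit ∧ (S.IsNormalized ∧ S.IsHermitian ∧ S.HasLinearGrowth ∧ S.IsReflectionPositive ∧ S.IsSymmetric ∧ S.HasClusterProperty ∧ (∀ (n : ℕ) (k : Fin n → YMSpecies G) (a : E) (F : SchwartzMap (Fin n → E) ℂ), IsOffDiagonal F → S n k (translateMulti a F) = S n k F) ∧ (∀ (n : ℕ) (k : Fin n → YMSpecies G) (R : E ≃ₗᵢ[ℝ] E), LinearMap.det (R.toLinearEquiv : E →ₗ[ℝ] E) = 1 → (∀ i : Fin 4, ∃ j : Fin 4, R (EuclideanSpace.single i 1) =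 EuclideanSpace.single j 1 ∨ R (EuclideanSpace.single i 1) = -EuclideanSpace.single j 1) → ∀ F : SchwartzMap (Fin n → E) ℂ, IsOffDiagonal F → S n k (linActMulti R F) = S n k F)) ∧ (∀ (n : ℕ), n ≠ 0 → ∀ (σ : Fin n → YMSpecies G) (f : Fin n → SchwartzMap (E) ℝ) (F : SchwartzMap (Fin n → E) ℂ), IsTensorOf F (fun i => ofRealTest (f i)) → IsOffDiagonal F → Filter.Tendsto (fun k : ℕ => ((latticeSchwinger r.ρ sch (fun s => s.F) k n σ f : ℝ) : ℂ)) Filter.atTop (nhds (S n σ F))) ∧ (∃ (F₁ G₁ : SchwartzMap (Fin 1 → E) ℂ) (H₁ : SchwartzMap (Fin (1 + 1) → E) ℂ), IsTimeOrdered F₁ ∧ IsTimeOrdered G₁ ∧ IsAppendTensorOf H₁ (osAdjoint F₁) G₁ ∧ S (1 + 1) (fun _ => r.curvature) H₁ ≠ S 1 (fun _ => r.curvature) (osAdjoint F₁) * S 1 (fun _ => r.curvature) G₁) ∧ (∃ (f g h : SchwartzMap (E) ℂ) (Ffgh : SchwartzMap (Fin 3 → E) ℂ) (Fgh Ffh Ffg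 : SchwartzMap (Fin 2 → E) ℂ) (Ff Fg Fh : SchwartzMap (Fin 1 → E) ℂ), IsTensorOf Ffgh ![f, g, h] ∧ IsOffDiagonal Ffgh ∧ IsTensorOf Fgh ![g, h] ∧ IsTensorOf Ffh ![f, h] ∧ IsTensorOf Ffg ![f, g] ∧ IsTensorOf Ff ![f] ∧ IsTensorOf Fg ![g] ∧ IsTensorOf Fh ![h] ∧ S 3 (fun _ => r.curvature) Ffgh - S 1 (fun _ => r.curvature) Ff * S 2 (fun _ => r.curvature) Fgh - S 1 (fun _ => r.curvature) Fg * S 2 (fun _ => r.curvature) Ffh - S 1 (fun _ => r.curvature) Fh * S 2 (fun _ => r.curvature) Ffg + 2 * (S 1 (fun _ => r.curvature) Ff * S 1 (fun _ => r.curvature) Fg * S 1 (fun _ => r.curvature) Fh) ≠ 0) ∧ (∃ Δ : ℝ, 0 < Δ ∧ S.HasMassGap Δ ∧ HasLatticeMassGap r sch Δ)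

/-- item stmt-QuantumFields-17723 · support · rank 9 · open · by planner
sources: OsterwalderSchrader1975, GlimmJaffe1987
[support] STEP 0 of the three engines (cruxes 9663 / 11686 / 14999): W1 + eight frames + cone ⇒
every 𝔖ₙ|⁰𝒮 of the curvature channel is integration against a function (NPointRegular). A COROLLARY
of T (proved in Sketch.lean, `stepZero_proof`); filed so that the three registered skeletons can
import one landing. [difficulty: provable-now] -/
@[route_item "route-QuantumFields-IsotropyFromPowerCounting", crux]
def CurvatureDensities : Prop :=
  open Literature.MathematicalPhysics.QuantumLattice Literature.MathematicalPhysics.AQFT Literature.MathematicalPhysics.QuantumFieldTheory Literature.Probability.LatticeModels Summit.QuantumFields.YangMills.Theorems.CurvatureBoostCovariance.Negative Summit.QuantumFields.YangMills.Theorems.NPointIsotropy.Negative in ∀ (G : Type) [Group G] [TopologicalSpace G] [IsTopologicalGroup G] [CompactSpace G] [MeasurableSpace G] [BorelSpace G], IsCompactSimpleLieGroup G → ∀ (r : LatticeRep G) (sch : SpeciesScheme (YMSpecies G)) (S₁ : SchwingerFamily E4), W1 r sch S₁ → EightFrameRP S₁ → PlanarCone S₁ → NPointRegular S₁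

-- earlier Assembly (stmt-QuantumFields-17724, replaced 2026-08-31T13:59:08Z -> stmt-QuantumFields-27396): proved by Summit.QuantumFields.YangMills.Theorems.isotropyFromPowerCounting_assembly_proof @ e83fe2a10a46 — CurvatureSandwichBound → TemperedCurvatureMoments → CurvatureKernelBound → DiagonalMirrorRPR → WeakCouplingHypercubicLimit → YangMills
/-- item stmt-QuantumFields-27396 · assembly · rank 1 · closed · proved by Summit.QuantumFields.YangMills.Theorems.isotropyFromPowerCounting_assembly_proof (prover) · by operator
sources: OsterwalderSchrader1975, JaffeWitten2000
[assembly] the deciding chain BY NAME after the FOLD (shape F), verbatim the curried type of the new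
`closes`: CurvatureSandwichBound → TemperedCurvatureMoments → CurvatureKernelBound →
WeakCouplingHypercubicLimitRP → YangMills. Restated by name so that the landed `unfold Assembly;
exact closes` proof elaborates again (IFPC: after a 1-line `intro` adapter). [difficulty:
provable-now] -/
@[route_item "route-QuantumFields-IsotropyFromPowerCounting"]
def Assembly : Prop :=
  CurvatureSandwichBound → TemperedCurvatureMoments → CurvatureKernelBound → WeakCouplingHypercubicLimitRP → YangMills

-- `Assembly` holds: proved by `Summit.QuantumFields.YangMills.Theorems.isotropyFromPowerCounting_assembly_proof` (its module imports this route file, so no `_holds` link can be stated here).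

/-! D-0027 §2.1 — DECIDING THEOREM (planner-authored via `route open/edit --closes-file`; by operator:999:345136 2026-08-31T13:59:08Z):
its hypotheses are this route's items and its conclusion the sub-problem Statement (glue_lint), and it elaborates with this file. -/

-- glue.lean — deciding theorem of route IsotropyFromPowerCounting after the FOLD (shape F; director-ym O4 WORD 1 (3); kit tenure-10604-restate-1-g1, 2026-08-31).
-- HOW THE STATEMENT'S CONJUNCT `sch.HasWeakCouplingLimit` IS SUPPLIED: as a HYPOTHESIS — the first conjunct of the existence-leg crux H_RP = WeakCouplingHypercubicLimitRP
-- (shared verbatim with MirrorModularBoosts; this route has no asymptotic-freedom input of its own), destructured by the parent's certified chain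
-- (`obtain ⟨r, sch, S, hweak, hRP, hW⟩ := hWHL G hG`), whose third mirror-line case now reads the leg's own diagonal-frame RP conjunct `hRP` (the universal crux
-- DiagonalMirrorRPR is an aside and no longer a binder). LOGIC-ONLY over six items: the cruxes Σ, T, K, H_RP and the two CERTIFIED items E (EngineFromPowerCounting:
-- T → Σ → B′) and C (PlanarSpectralCone), consumed as binders because their proof modules carry unproved Literature facts by module co-location that must stay out of
-- this file's import cone; then MirrorModularBoosts' re-glued chain (K, B′ := E T Σ, C, H_RP ⊢ YangMills) BY NAME — so this file elaborates only after the
-- MirrorModularBoosts rev lands and its module is rebuilt. Every binder is load-bearing. HONEST LABEL as in MirrorModularBoosts' glue: nothing proved; YM mass gap NOT proved.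
@[closes "route-QuantumFields-IsotropyFromPowerCounting"] theorem closes (hSig : CurvatureSandwichBound) (hT : TemperedCurvatureMoments) (hK : CurvatureKernelBound)
    (hH : WeakCouplingHypercubicLimitRP) (hE : EngineFromPowerCounting) (hC : PlanarSpectralCone) : YangMills :=
  Summit.QuantumFields.YangMills.Theses.MirrorModularBoosts.closes hK (hE hT hSig) hC hH

end Summit.QuantumFields.YangMills.Theses.IsotropyFromPowerCounting
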